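import Mathlib
import HarnessLib

/-!
# Markov and Bernstein certificates for bounded Boolean cubics
# (the two polynomial-inequality constants of the seat's §4.30–§4.31, with no analysis)

Solo seat `solo-QuantumAdvantage-informed`, session 15, file 34 (§4.31 (5) PROPOSITION Π and
§4.30 (2) (F-lin) of the seat's paper `paper/sharpest-statement.md`).

A multilinear polynomial of degree `≤ 3` on the cube is given by a coefficient function
`c : Finset (Fin n) → ℝ` with `c U = 0` unless `#U ≤ 3`, evaluated at `x : Fin n → ℝ` as
`Σ_U c U · Π_{i ∈ U} x i`; "bounded" means `|Σ_U c U Π_{i∈U} y i| ≤ 1` at every sign vector `y`.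
Everything below is finite algebra — no derivative, no extension to the solid cube:

* `flipAverage_eq` — the NOISE IDENTITY as an explicit convex combination: flipping each
  coordinate of `S` independently with probability `t` averages the polynomial to
  `Σ_U c U x^U (1 − 2t)^{#(U ∩ S)}`; written as the finite sum over `V ⊆ S` with weights
  `t^{#V}(1 − t)^{#S − #V}` (proof: `Finset.prod_add`). Hence `flipAverage_abs_le`: that quantity is
  `≤ 1` in absolute value for `t ∈ [0,1]` whenever the cubic is bounded.
* `certificate_markov` — for `k ∈ {0,1,2,3}`:
  `2k = (19/3)·1 − 8·(1/2)^k + (8/3)·(−1/2)^k − (−1)^k`, i.e. the derivative at `0` of a cubic on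
  `[0,1]` is the signed combination of its values at `0, 1/4, 3/4, 1` with total weight `18`
  (Markov's constant `2·3²`, realised by interpolation at the Chebyshev extrema).
  Consequence `directional_markov`: for every vertex `x` and every set `S`,
  `|Σ_{i∈S} (p(x) − p(x ⊕ i))| ≤ 18`, and `sum_abs_diff_le`: `Σ_i |p(x) − p(x ⊕ i)| ≤ 36`
  — equivalently `‖∇p(x)‖₁ ≤ 18` at every vertex, DIMENSION-FREE. This is the constant of
  PROPOSITION Π (pointwise-influence tail certificate) in §4.31 (5).
* `certificate_bernstein` — for `k ∈ {0,1,2,3}`: `6·[k = 1] = 8((1/2)^k − (−1/2)^k) − (1 − (−1)^k)`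
  (Bernstein's constant `3` at the centre, interpolation at `±1/2, ±1`). Consequence
  `linear_coeff_l1_le`: the degree-one coefficients of a bounded cubic have `Σ_i |c {i}| ≤ 3`
  — the fact (F-lin) used for the linear threshold in THEOREM E‴/E⁗ (§4.30 (2), §4.31 (2)).

Both constants are those of the univariate Markov / Bernstein inequalities for cubics and are
asymptotically attained by `p(x) = T₃((x₁ + ⋯ + x_m)/m)` as `m → ∞`; no sharpness is claimed here.
Trust base: Mathlib only. No definitions are introduced (sums are written out).
-/

namespace Summit.QuantumAdvantage.QuantumAdvantage.Theorems

namespace MarkovCertificates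

open Finset

variable {n : ℕ}

/-! ## Flipping coordinates and the noise identity -/

/-- Flipping the coordinates in `V` multiplies the monomial `x^U` by `(−1)^{#(U ∩ V)}`. -/
theorem prod_flip (x : Fin n → ℝ) (U V : Finset (Fin n)) :
    ∏ i ∈ U, (if i ∈ V then -x i else x i) = (-1) ^ (U ∩ V).card * ∏ i ∈ U, x i := by
  have h1 : ∀ i ∈ U, (if i ∈ V then -x i else x i) = (if i ∈ V then (-1:ℝ) else 1) * x i := by
    intro i _
    split_ifs <;> ring
  rw [prod_congr rfl h1, prod_mul_distrib, prod_ite_mem, prod_const]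

/-- The polynomial at the flipped point, monomial by monomial. -/
theorem eval_flip (c : Finset (Fin n) → ℝ) (x : Fin n → ℝ) (V : Finset (Fin n)) :
    ∑ U : Finset (Fin n), c U * ∏ i ∈ U, (if i ∈ V then -x i else x i)
      = ∑ U : Finset (Fin n), c U * ((-1) ^ (U ∩ V).card * ∏ i ∈ U, x i) := by
  refine sum_congr rfl fun U _ => ?_
  rw [prod_flip]

/-- NOISE IDENTITY (explicit convex combination). Averaging the polynomial over the points obtained
from `x` by flipping each coordinate of `S` independently with probability `t` — written as the
finite sum over the flipped set `V ⊆ S` with weight `t^{#V} (1−t)^{#S−#V}` — gives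
`Σ_U c U · x^U · (1 − 2t)^{#(U ∩ S)}`. Valid for all real `x` and `t`. -/
theorem flipAverage_eq (c : Finset (Fin n) → ℝ) (x : Fin n → ℝ) (S : Finset (Fin n)) (t : ℝ) :
    ∑ V ∈ S.powerset, t ^ V.card * (1 - t) ^ (S.card - V.card) *
        (∑ U : Finset (Fin n), c U * ∏ i ∈ U, (if i ∈ V then -x i else x i))
      = ∑ U : Finset (Fin n), c U * (∏ i ∈ U, x i) * (1 - 2 * t) ^ (U ∩ S).card := by
  classical
  have key : ∀ U : Finset (Fin n),
      ∑ V ∈ S.powerset, t ^ V.card * (1 - t) ^ (S.card - V.card) * (-1 : ℝ) ^ (U ∩ V).card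
        = (1 - 2 * t) ^ (U ∩ S).card := by
    intro U
    have h : ∏ i ∈ S, (t * (if i ∈ U then (-1:ℝ) else 1) + (1 - t))
        = ∑ V ∈ S.powerset, (∏ i ∈ V, t * (if i ∈ U then (-1:ℝ) else 1)) *
            ∏ i ∈ S \ V, ((1:ℝ) - t) :=
      Finset.prod_add (fun i => t * (if i ∈ U then (-1:ℝ) else 1)) (fun _ => (1:ℝ) - t) S
    have hl : ∏ i ∈ S, (t * (if i ∈ U then (-1:ℝ) else 1) + (1 - t))
        = (1 - 2 * t) ^ (U ∩ S).card := by
      have h2 : ∀ i ∈ S, (t * (if i ∈ U then (-1:ℝ) else 1) + (1 - t))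
          = (if i ∈ U then (1 - 2 * t) else 1) := by
        intro i _
        split_ifs <;> ring
      rw [prod_congr rfl h2, prod_ite_mem, prod_const, inter_comm]
    have hr : ∀ V ∈ S.powerset,
        (∏ i ∈ V, t * (if i ∈ U then (-1:ℝ) else 1)) * ∏ i ∈ S \ V, ((1:ℝ) - t)
          = t ^ V.card * (1 - t) ^ (S.card - V.card) * (-1 : ℝ) ^ (U ∩ V).card := by
      intro V hV
      rw [prod_mul_distrib, prod_const, prod_ite_mem, prod_const, prod_const,
        card_sdiff_of_subset (mem_powerset.1 hV), inter_comm]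
      ring
    rw [← hl, h]
    exact (sum_congr rfl hr).symm
  calc ∑ V ∈ S.powerset, t ^ V.card * (1 - t) ^ (S.card - V.card) *
          (∑ U : Finset (Fin n), c U * ∏ i ∈ U, (if i ∈ V then -x i else x i))
      = ∑ V ∈ S.powerset, ∑ U : Finset (Fin n), t ^ V.card * (1 - t) ^ (S.card - V.card) *
          (c U * ((-1) ^ (U ∩ V).card * ∏ i ∈ U, x i)) := by
        refine sum_congr rfl fun V _ => ?_
        rw [eval_flip, mul_sum]
    _ = ∑ U : Finset (Fin n), ∑ V ∈ S.powerset, t ^ V.card * (1 - t) ^ (S.card - V.card) *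
          (c U * ((-1) ^ (U ∩ V).card * ∏ i ∈ U, x i)) := sum_comm
    _ = ∑ U : Finset (Fin n), c U * (∏ i ∈ U, x i) * (1 - 2 * t) ^ (U ∩ S).card := by
        refine sum_congr rfl fun U _ => ?_
        rw [← key U, mul_sum]
        refine sum_congr rfl fun V _ => ?_
        ring

/-- A flipped sign vector is a sign vector. -/
theorem flip_sign {x : Fin n → ℝ} (hx : ∀ i, x i = 1 ∨ x i = -1) (V : Finset (Fin n)) :
    ∀ i, (fun j => if j ∈ V then -x j else x j) i = 1 ∨
      (fun j => if j ∈ V then -x j else x j) i = -1 := by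
  intro i
  rcases hx i with h | h <;> by_cases hi : i ∈ V <;> simp [hi, h]

/-- The noise average of a bounded polynomial is bounded: for `t ∈ [0,1]`,
`|Σ_U c U x^U (1 − 2t)^{#(U ∩ S)}| ≤ 1` (it is a convex combination of values at vertices). -/
theorem flipAverage_abs_le (c : Finset (Fin n) → ℝ) (x : Fin n → ℝ)
    (hx : ∀ i, x i = 1 ∨ x i = -1)
    (hb : ∀ y : Fin n → ℝ, (∀ i, y i = 1 ∨ y i = -1) →
      |∑ U : Finset (Fin n), c U * ∏ i ∈ U, y i| ≤ 1)
    (S : Finset (Fin n)) (t : ℝ) (ht0 : 0 ≤ t) (ht1 : t ≤ 1) :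
    |∑ U : Finset (Fin n), c U * (∏ i ∈ U, x i) * (1 - 2 * t) ^ (U ∩ S).card| ≤ 1 := by
  classical
  rw [← flipAverage_eq]
  have h1t : 0 ≤ 1 - t := sub_nonneg.2 ht1
  calc |∑ V ∈ S.powerset, t ^ V.card * (1 - t) ^ (S.card - V.card) *
          (∑ U : Finset (Fin n), c U * ∏ i ∈ U, (if i ∈ V then -x i else x i))|
      ≤ ∑ V ∈ S.powerset, |t ^ V.card * (1 - t) ^ (S.card - V.card) *
          (∑ U : Finset (Fin n), c U * ∏ i ∈ U, (if i ∈ V then -x i else x i))| :=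
        abs_sum_le_sum_abs _ _
    _ ≤ ∑ V ∈ S.powerset, t ^ V.card * (1 - t) ^ (S.card - V.card) := by
        refine sum_le_sum fun V _ => ?_
        have hw : 0 ≤ t ^ V.card * (1 - t) ^ (S.card - V.card) :=
          mul_nonneg (pow_nonneg ht0 _) (pow_nonneg h1t _)
        rw [abs_mul, abs_of_nonneg hw]
        exact mul_le_of_le_one_right hw (hb _ (flip_sign hx V))
    _ = (t + (1 - t)) ^ S.card := sum_pow_mul_eq_add_pow _ _ _
    _ = 1 := by rw [show t + (1 - t) = (1:ℝ) by ring, one_pow]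

/-! ## Two arithmetic certificates (kept separate so that `linarith` sees only scalars) -/

/-- `|19/3·E₀ − 8E₁ + 8/3·E₂ − E₃| ≤ 19/3 + 8 + 8/3 + 1 = 18` on `[−1,1]⁴`. -/
theorem markov_arith {E₀ E₁ E₂ E₃ : ℝ} (h₀ : |E₀| ≤ 1) (h₁ : |E₁| ≤ 1) (h₂ : |E₂| ≤ 1)
    (h₃ : |E₃| ≤ 1) : |19 / 3 * E₀ - 8 * E₁ + 8 / 3 * E₂ - E₃| ≤ 18 := by
  rw [abs_le] at h₀ h₁ h₂ h₃ ⊢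
  constructor <;> linarith [h₀.1, h₀.2, h₁.1, h₁.2, h₂.1, h₂.2, h₃.1, h₃.2]

/-- `6L = 8(E₁ − E₂) − (E₀ − E₃)` with `|Eᵢ| ≤ 1` gives `L ≤ 3`. -/
theorem bernstein_arith {E₀ E₁ E₂ E₃ L : ℝ} (h₀ : |E₀| ≤ 1) (h₁ : |E₁| ≤ 1) (h₂ : |E₂| ≤ 1)
    (h₃ : |E₃| ≤ 1) (hL : 6 * L = 8 * (E₁ - E₂) - (E₀ - E₃)) : L ≤ 3 := by
  rw [abs_le] at h₀ h₁ h₂ h₃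
  linarith [h₀.1, h₀.2, h₁.1, h₁.2, h₂.1, h₂.2, h₃.1, h₃.2]

/-! ## The Markov certificate: `‖∇p(x)‖₁ ≤ 18` at every vertex -/

/-- The discrete derivative: `p(x) − p(x ⊕ i) = 2 Σ_{U ∋ i} c U x^U`. -/
theorem diff_eq (c : Finset (Fin n) → ℝ) (x : Fin n → ℝ) (i : Fin n) :
    (∑ U : Finset (Fin n), c U * ∏ j ∈ U, x j)
      - (∑ U : Finset (Fin n), c U * ∏ j ∈ U, (if j ∈ ({i} : Finset (Fin n)) then -x j else x j))
      = 2 * ∑ U : Finset (Fin n), (if i ∈ U then c U * ∏ j ∈ U, x j else 0) := by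
  classical
  rw [eval_flip, ← sum_sub_distrib, mul_sum]
  refine sum_congr rfl fun U _ => ?_
  by_cases hi : i ∈ U
  · rw [inter_singleton_of_mem hi, card_singleton, if_pos hi]
    ring
  · rw [inter_singleton_of_notMem hi, card_empty, if_neg hi]
    ring

/-- Summing the derivatives over `i ∈ S` counts each monomial `#(U ∩ S)` times. -/
theorem sum_deriv_eq (c : Finset (Fin n) → ℝ) (x : Fin n → ℝ) (S : Finset (Fin n)) :
    ∑ i ∈ S, ∑ U : Finset (Fin n), (if i ∈ U then c U * ∏ j ∈ U, x j else 0)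
      = ∑ U : Finset (Fin n), c U * (∏ j ∈ U, x j) * ((U ∩ S).card : ℝ) := by
  classical
  rw [sum_comm]
  refine sum_congr rfl fun U _ => ?_
  rw [← sum_filter, filter_mem_eq_inter, sum_const, inter_comm, nsmul_eq_mul]
  ring

/-- MARKOV CERTIFICATE. For a polynomial of degree `≤ 3`,
`Σ_U c U x^U · 2#(U ∩ S) = (19/3)A(0) − 8A(1/4) + (8/3)A(3/4) − A(1)` where
`A(t) = Σ_U c U x^U (1−2t)^{#(U∩S)}` is the noise average; termwise this is the identity
`2k = 19/3 − 8(1/2)^k + (8/3)(−1/2)^k − (−1)^k` for `k ∈ {0,1,2,3}`. -/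
theorem certificate_markov (c : Finset (Fin n) → ℝ) (hdeg : ∀ U, c U ≠ 0 → U.card ≤ 3)
    (x : Fin n → ℝ) (S : Finset (Fin n)) :
    ∑ U : Finset (Fin n), c U * (∏ j ∈ U, x j) * (2 * ((U ∩ S).card : ℝ))
      = (19/3) * (∑ U : Finset (Fin n), c U * (∏ j ∈ U, x j) * (1 - 2 * (0:ℝ)) ^ (U ∩ S).card)
        - 8 * (∑ U : Finset (Fin n), c U * (∏ j ∈ U, x j) * (1 - 2 * (1/4:ℝ)) ^ (U ∩ S).card)
        + (8/3) * (∑ U : Finset (Fin n), c U * (∏ j ∈ U, x j) * (1 - 2 * (3/4:ℝ)) ^ (U ∩ S).card)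
        - (∑ U : Finset (Fin n), c U * (∏ j ∈ U, x j) * (1 - 2 * (1:ℝ)) ^ (U ∩ S).card) := by
  classical
  rw [mul_sum, mul_sum, mul_sum, ← sum_sub_distrib, ← sum_add_distrib, ← sum_sub_distrib]
  refine sum_congr rfl fun U _ => ?_
  by_cases hc : c U = 0
  · simp [hc]
  · have hk : (U ∩ S).card ≤ 3 := (card_le_card inter_subset_left).trans (hdeg U hc)
    generalize (U ∩ S).card = k at hk ⊢
    rcases (show k = 0 ∨ k = 1 ∨ k = 2 ∨ k = 3 by omega) with rfl | rfl | rfl | rfl <;>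
      norm_num <;> ring

/-- DIRECTIONAL MARKOV. For a bounded cubic, every vertex `x` and every set `S` of directions:
`|Σ_{i ∈ S} (p(x) − p(x ⊕ i))| ≤ 18`. -/
theorem directional_markov (c : Finset (Fin n) → ℝ) (hdeg : ∀ U, c U ≠ 0 → U.card ≤ 3)
    (hb : ∀ y : Fin n → ℝ, (∀ i, y i = 1 ∨ y i = -1) →
      |∑ U : Finset (Fin n), c U * ∏ i ∈ U, y i| ≤ 1)
    (x : Fin n → ℝ) (hx : ∀ i, x i = 1 ∨ x i = -1) (S : Finset (Fin n)) :
    |∑ i ∈ S, ((∑ U : Finset (Fin n), c U * ∏ j ∈ U, x j)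
        - ∑ U : Finset (Fin n), c U * ∏ j ∈ U, (if j ∈ ({i} : Finset (Fin n)) then -x j else x j))|
      ≤ 18 := by
  classical
  have h1 : ∑ i ∈ S, ((∑ U : Finset (Fin n), c U * ∏ j ∈ U, x j)
        - ∑ U : Finset (Fin n), c U * ∏ j ∈ U, (if j ∈ ({i} : Finset (Fin n)) then -x j else x j))
      = ∑ U : Finset (Fin n), c U * (∏ j ∈ U, x j) * (2 * ((U ∩ S).card : ℝ)) := by
    rw [sum_congr rfl fun i _ => diff_eq c x i, ← mul_sum, sum_deriv_eq, mul_sum]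
    refine sum_congr rfl fun U _ => ?_
    ring
  rw [h1, certificate_markov c hdeg x S]
  exact markov_arith (flipAverage_abs_le c x hx hb S 0 le_rfl zero_le_one)
    (flipAverage_abs_le c x hx hb S (1/4) (by norm_num) (by norm_num))
    (flipAverage_abs_le c x hx hb S (3/4) (by norm_num) (by norm_num))
    (flipAverage_abs_le c x hx hb S 1 zero_le_one le_rfl)

/-- From a directional bound to an `ℓ₁` bound: if `|Σ_{i∈S} D i| ≤ B` for every `S` then
`Σ_i |D i| ≤ 2B` (take `S` = the nonnegative and the negative coordinates). -/
theorem sum_abs_le_of_directional {m : ℕ} (D : Fin m → ℝ) {B : ℝ}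
    (h : ∀ S : Finset (Fin m), |∑ i ∈ S, D i| ≤ B) : ∑ i, |D i| ≤ 2 * B := by
  classical
  have hp := h (univ.filter fun i => 0 ≤ D i)
  have hn := h (univ.filter fun i => ¬ (0 ≤ D i))
  have hsplit : ∑ i, |D i| = (∑ i ∈ univ.filter (fun i => 0 ≤ D i), D i)
      - ∑ i ∈ univ.filter (fun i => ¬ (0 ≤ D i)), D i := by
    rw [← sum_filter_add_sum_filter_not univ (fun i => 0 ≤ D i) (fun i => |D i|),
      sub_eq_add_neg, ← sum_neg_distrib]
    congr 1
    · exact sum_congr rfl fun i hi => abs_of_nonneg (mem_filter.1 hi).2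
    · exact sum_congr rfl fun i hi => abs_of_neg (lt_of_not_ge (mem_filter.1 hi).2)
  rw [hsplit]
  have h1 := (abs_le.1 hp).2
  have h2 := (abs_le.1 hn).1
  linarith

/-- GRADIENT `ℓ₁` BOUND (the constant of PROPOSITION Π). For a bounded cubic and every vertex `x`:
`Σ_i |p(x) − p(x ⊕ i)| ≤ 36`, i.e. `Σ_i |∂_i p(x)| ≤ 18`, uniformly in the dimension `n`. -/
theorem sum_abs_diff_le (c : Finset (Fin n) → ℝ) (hdeg : ∀ U, c U ≠ 0 → U.card ≤ 3)
    (hb : ∀ y : Fin n → ℝ, (∀ i, y i = 1 ∨ y i = -1) →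
      |∑ U : Finset (Fin n), c U * ∏ i ∈ U, y i| ≤ 1)
    (x : Fin n → ℝ) (hx : ∀ i, x i = 1 ∨ x i = -1) :
    ∑ i : Fin n, |(∑ U : Finset (Fin n), c U * ∏ j ∈ U, x j)
        - ∑ U : Finset (Fin n), c U * ∏ j ∈ U, (if j ∈ ({i} : Finset (Fin n)) then -x j else x j)|
      ≤ 36 := by
  have h := sum_abs_le_of_directional
    (fun i => (∑ U : Finset (Fin n), c U * ∏ j ∈ U, x j)
      - ∑ U : Finset (Fin n), c U * ∏ j ∈ U, (if j ∈ ({i} : Finset (Fin n)) then -x j else x j))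
    (fun S => directional_markov c hdeg hb x hx S)
  exact h.trans (by norm_num)

/-! ## The Bernstein certificate: `Σ_i |c {i}| ≤ 3` -/

/-- BERNSTEIN CERTIFICATE. For a polynomial of degree `≤ 3`, with `A(t)` the full noise average
(`S = univ`): `6 Σ_{#U = 1} c U x^U = 8(A(1/4) − A(3/4)) − (A(0) − A(1))`; termwise
`6·[k = 1] = 8((1/2)^k − (−1/2)^k) − (1 − (−1)^k)` for `k ∈ {0,1,2,3}`. -/
theorem certificate_bernstein (c : Finset (Fin n) → ℝ) (hdeg : ∀ U, c U ≠ 0 → U.card ≤ 3)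
    (x : Fin n → ℝ) :
    6 * ∑ U : Finset (Fin n), (if U.card = 1 then c U * ∏ j ∈ U, x j else 0)
      = 8 * ((∑ U : Finset (Fin n), c U * (∏ j ∈ U, x j) *
                (1 - 2 * (1/4:ℝ)) ^ (U ∩ (univ : Finset (Fin n))).card)
             - ∑ U : Finset (Fin n), c U * (∏ j ∈ U, x j) *
                (1 - 2 * (3/4:ℝ)) ^ (U ∩ (univ : Finset (Fin n))).card)
        - ((∑ U : Finset (Fin n), c U * (∏ j ∈ U, x j) *
                (1 - 2 * (0:ℝ)) ^ (U ∩ (univ : Finset (Fin n))).card)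
             - ∑ U : Finset (Fin n), c U * (∏ j ∈ U, x j) *
                (1 - 2 * (1:ℝ)) ^ (U ∩ (univ : Finset (Fin n))).card) := by
  classical
  simp only [inter_univ]
  rw [← sum_sub_distrib, ← sum_sub_distrib, mul_sum, mul_sum, ← sum_sub_distrib]
  refine sum_congr rfl fun U _ => ?_
  by_cases hc : c U = 0
  · simp [hc]
  · have hk : U.card ≤ 3 := hdeg U hc
    generalize U.card = k at hk ⊢
    rcases (show k = 0 ∨ k = 1 ∨ k = 2 ∨ k = 3 by omega) with rfl | rfl | rfl | rfl <;>
      norm_num <;> ring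

/-- (F-lin) THE DEGREE-ONE COEFFICIENTS OF A BOUNDED CUBIC HAVE `ℓ₁`-NORM AT MOST `3`
(Bernstein's constant; dimension-free). -/
theorem linear_coeff_l1_le (c : Finset (Fin n) → ℝ) (hdeg : ∀ U, c U ≠ 0 → U.card ≤ 3)
    (hb : ∀ y : Fin n → ℝ, (∀ i, y i = 1 ∨ y i = -1) →
      |∑ U : Finset (Fin n), c U * ∏ i ∈ U, y i| ≤ 1) :
    ∑ i : Fin n, |c {i}| ≤ 3 := by
  classical
  -- the sign vector of the linear coefficients
  have hsgn : ∀ i, (fun i : Fin n => if 0 ≤ c {i} then (1:ℝ) else -1) i = 1 ∨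
      (fun i : Fin n => if 0 ≤ c {i} then (1:ℝ) else -1) i = -1 := by
    intro i
    by_cases h : 0 ≤ c {i} <;> simp [h]
  have hsing : ∑ i : Fin n, |c {i}|
      = ∑ U : Finset (Fin n), (if U.card = 1 then
          c U * ∏ j ∈ U, (fun i : Fin n => if 0 ≤ c {i} then (1:ℝ) else -1) j else 0) := by
    have h1 : ∀ i : Fin n, |c {i}|
        = c {i} * ∏ j ∈ ({i} : Finset (Fin n)), (fun i : Fin n => if 0 ≤ c {i} then (1:ℝ) else -1) j := by
      intro i
      rw [prod_singleton]
      by_cases h : 0 ≤ c {i}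
      · simp [h, abs_of_nonneg h]
      · simp [h, abs_of_neg (lt_of_not_ge h)]
    calc ∑ i : Fin n, |c {i}|
        = ∑ i : Fin n, c {i} * ∏ j ∈ ({i} : Finset (Fin n)),
            (fun i : Fin n => if 0 ≤ c {i} then (1:ℝ) else -1) j := sum_congr rfl fun i _ => h1 i
      _ = ∑ i : Fin n, ∑ U : Finset (Fin n), (if U = {i} then
            c U * ∏ j ∈ U, (fun i : Fin n => if 0 ≤ c {i} then (1:ℝ) else -1) j else 0) := by
          refine sum_congr rfl fun i _ => ?_
          rw [Fintype.sum_ite_eq' ({i} : Finset (Fin n))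
            (fun U => c U * ∏ j ∈ U, (fun i : Fin n => if 0 ≤ c {i} then (1:ℝ) else -1) j)]
      _ = ∑ U : Finset (Fin n), ∑ i : Fin n, (if U = {i} then
            c U * ∏ j ∈ U, (fun i : Fin n => if 0 ≤ c {i} then (1:ℝ) else -1) j else 0) :=
          sum_comm
      _ = ∑ U : Finset (Fin n), (if U.card = 1 then
            c U * ∏ j ∈ U, (fun i : Fin n => if 0 ≤ c {i} then (1:ℝ) else -1) j else 0) := by
          refine sum_congr rfl fun U _ => ?_
          by_cases hU : U.card = 1
          · obtain ⟨a, rfl⟩ := card_eq_one.1 hU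
            rw [if_pos hU]
            simp only [singleton_inj]
            rw [Fintype.sum_ite_eq]
          · have hne : ∀ i : Fin n, U ≠ {i} := fun i h => hU (by rw [h, card_singleton])
            simp [hne, hU]
  have key := certificate_bernstein c hdeg (fun i : Fin n => if 0 ≤ c {i} then (1:ℝ) else -1)
  rw [hsing]
  exact bernstein_arith
    (flipAverage_abs_le c (fun i : Fin n => if 0 ≤ c {i} then (1:ℝ) else -1) hsgn hb univ 0
      le_rfl zero_le_one)
    (flipAverage_abs_le c (fun i : Fin n => if 0 ≤ c {i} then (1:ℝ) else -1) hsgn hb univ (1/4)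
      (by norm_num) (by norm_num))
    (flipAverage_abs_le c (fun i : Fin n => if 0 ≤ c {i} then (1:ℝ) else -1) hsgn hb univ (3/4)
      (by norm_num) (by norm_num))
    (flipAverage_abs_le c (fun i : Fin n => if 0 ≤ c {i} then (1:ℝ) else -1) hsgn hb univ 1
      zero_le_one le_rfl)
    key

end MarkovCertificates

end Summit.QuantumAdvantage.QuantumAdvantage.Theorems
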